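import Summits.AtomisticToContinuum.HydrodynamicLimit.Theses.JParityClosure
import Summits.AtomisticToContinuum.HydrodynamicLimit.Theses.SuperextensiveClosureCost
import Literature.MathematicalPhysics.KineticTheory.EvenCollisionTubeFunctional
import Literature.Probability.Entropy.EntropyInequality

/-!
# Sketch — crux-ideate round 2, ideator 4, crux `JParityClosure.OddContactSymmetry` (stmt-AtomisticToContinuum-13078)

First lemmas / typed bets of the two idea cards of this seat:

* Card `subkolmogorov-twist-ld-transfer` (§A): `twist_log_residual_le` (PROVED: the twist residual `|F|` is at most four times the
  log-sup-distance of the queried one-body law to the log-quadratic family — quantitative form of the disprover's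
  `twisted_balance_of_logQuadratic`), `exp_neg_twist_le` (PROVED corollary), the typed transfer target
  `MesoShellOddSymmetry` (C⁺: the crux with energy-shell marks and the twist read at the mesoscopic scale
  `r_N = (N+1)^{-1/3+a}`), the typed bet `OddTwistCost` (superexponential cost under the invariant law), and the real
  arithmetic of the transfer `transfer_of_cost` (PROVED).
* Card `collision-flux-first-moment` (§B): the typed rung-0 flux identity `EquilibriumCollisionFlux` (Palm law of incoming
  contact data under the invariant Gibbs law is flux-weighted chaotic-Maxwellian up to ONE scalar), its typed corollary
  `RungZeroOddMeanExact`, and the counting-Markov step `meas_one_le_count_le_lintegral` (PROVED) that turns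
  "no contributing collision ever sees an irregular r-ball cloud" into a first-moment estimate.
-/

noncomputable section

open scoped InnerProductSpace BigOperators ENNReal
open MeasureTheory
open Literature.Analysis.FluidPDE Literature.MathematicalPhysics.KineticTheory

namespace Summit.AtomisticToContinuum.HydrodynamicLimit.Cruxes.OddContactSymmetry.IdeatorFour

/-! ## §A  Card `subkolmogorov-twist-ld-transfer` -/

/-- **Twist residual ≤ 4 × log-distance to the log-quadratic family (First lemma of card A).**
If at the four velocities queried by the crux at one collision — the pre-collisional pair `(v, w)` and the post-collisional
pair `(v′, w′) = reflectVel n (v, w)` — the queried one-body law `h` is within `ε` in LOG scale of one log-quadratic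
function `u ↦ α + β‖u‖² + ⟪γ, u⟫` (a local Maxwellian with ANY parameters, read at the finest scale where it is one), then
the surprisal jump `F = log h(v) + log h(w) − log h(v′) − log h(w′)` satisfies `|F| ≤ 4ε`: momentum and energy
conservation of `reflectVel` kill the log-quadratic part exactly (tree: `twisted_balance_of_logQuadratic` is the case
`ε = 0`).  This is the deterministic core of "the mesoscopic twist measures pure kinetic non-equilibrium": the crux weight
`1 + e^{−F}` differs from `2` by at most `e^{4ε} − 1` wherever the r_N-ball law is ε-close to a single Maxwellian on the
energy shell. [folklore] -/
theorem twist_log_residual_le (h : V3 → ℝ) (α β ε : ℝ) (γ n v w : V3)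
    (hv : |Real.log (h v) - (α + β * ‖v‖ ^ 2 + ⟪γ, v⟫_ℝ)| ≤ ε)
    (hw : |Real.log (h w) - (α + β * ‖w‖ ^ 2 + ⟪γ, w⟫_ℝ)| ≤ ε)
    (hv' : |Real.log (h (reflectVel n (v, w)).1) -
        (α + β * ‖(reflectVel n (v, w)).1‖ ^ 2 + ⟪γ, (reflectVel n (v, w)).1⟫_ℝ)| ≤ ε)
    (hw' : |Real.log (h (reflectVel n (v, w)).2) -
        (α + β * ‖(reflectVel n (v, w)).2‖ ^ 2 + ⟪γ, (reflectVel n (v, w)).2⟫_ℝ)| ≤ ε) :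
    |Real.log (h v) + Real.log (h w) - Real.log (h (reflectVel n (v, w)).1) -
        Real.log (h (reflectVel n (v, w)).2)| ≤ 4 * ε := by
  have hE := norm_sq_reflectVel_fst_add_norm_sq_reflectVel_snd n (v, w)
  have hP := reflectVel_fst_add_reflectVel_snd n (v, w)
  dsimp only at hE hP
  have hI : ⟪γ, (reflectVel n (v, w)).1⟫_ℝ + ⟪γ, (reflectVel n (v, w)).2⟫_ℝ = ⟪γ, v⟫_ℝ + ⟪γ, w⟫_ℝ := by
    rw [← inner_add_right, ← inner_add_right, hP]
  have key : (α + β * ‖v‖ ^ 2 + ⟪γ, v⟫_ℝ) + (α + β * ‖w‖ ^ 2 + ⟪γ, w⟫_ℝ) -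
      (α + β * ‖(reflectVel n (v, w)).1‖ ^ 2 + ⟪γ, (reflectVel n (v, w)).1⟫_ℝ) -
      (α + β * ‖(reflectVel n (v, w)).2‖ ^ 2 + ⟪γ, (reflectVel n (v, w)).2⟫_ℝ) = 0 := by
    linear_combination (-β) * hE - hI
  rw [abs_le] at hv hw hv' hw' ⊢
  obtain ⟨hv1, hv2⟩ := hv
  obtain ⟨hw1, hw2⟩ := hw
  obtain ⟨hv'1, hv'2⟩ := hv'
  obtain ⟨hw'1, hw'2⟩ := hw'
  constructor <;> linarith

/-- Corollary: under the same hypotheses the crux's reweighting factor is bounded, `e^{−F} ≤ e^{4ε}` — the twist cannot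
blow up at a collision all of whose queries sit where the mollified law is log-close to ONE Maxwellian (contrast
`exp_neg_surprisal_ge`, the velocity-hole weight, where no such Maxwellian exists at the pre-collisional queries).
[folklore] -/
theorem exp_neg_twist_le (h : V3 → ℝ) (α β ε : ℝ) (γ n v w : V3)
    (hv : |Real.log (h v) - (α + β * ‖v‖ ^ 2 + ⟪γ, v⟫_ℝ)| ≤ ε)
    (hw : |Real.log (h w) - (α + β * ‖w‖ ^ 2 + ⟪γ, w⟫_ℝ)| ≤ ε)
    (hv' : |Real.log (h (reflectVel n (v, w)).1) -
        (α + β * ‖(reflectVel n (v, w)).1‖ ^ 2 + ⟪γ, (reflectVel n (v, w)).1⟫_ℝ)| ≤ ε)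
    (hw' : |Real.log (h (reflectVel n (v, w)).2) -
        (α + β * ‖(reflectVel n (v, w)).2‖ ^ 2 + ⟪γ, (reflectVel n (v, w)).2⟫_ℝ)| ≤ ε) :
    Real.exp (-(Real.log (h v) + Real.log (h w) - Real.log (h (reflectVel n (v, w)).1) -
        Real.log (h (reflectVel n (v, w)).2))) ≤ Real.exp (4 * ε) := by
  have := twist_log_residual_le h α β ε γ n v w hv hw hv' hw'
  rw [abs_le] at this
  exact Real.exp_le_exp.2 (by linarith [this.1])

/-- **C⁺ — `MesoShellOddSymmetry`: the crux with energy-shell marks and a MESOSCOPIC twist (the Transfer target of card A).**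
Verbatim the route declaration `JParityClosure.OddContactSymmetry` (through the tree functional `oddStat`, which is its
`let`-chain), with exactly three changes: (i) the marks `Ψ` vanish outside an energy shell `‖v‖² + ‖w‖² < R` (the
unanimous repair C′₁ of the velocity-hole defect; `reflectVel` preserves the shell, so the class is `J`-stable);
(ii) the one-body law entering the surprisal jump `F` (and the density cutoff) is read at the N-DEPENDENT scale
`r_N = (N+1)^{−1/3+a}` — above the mean free path `≍ (N+1)^{−1/3}`, below the dissipation (Kolmogorov) scale
`≍ Kn^{3/4} = (N+1)^{−1/4}` and small enough (`a < 1/18`) that velocity-hole conspiracies are superexponentially expensive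
under the invariant law — for EVERY exponent `a ∈ (0, 1/18)`; (iii) consequently no `∃ r₀ ∀ r < r₀` block: only the
velocity resolution `ϑ` is sent to `0` after `N → ∞`.  All horizons `τ > 0`, all profiles (no Euler solution in the
statement: the kinetic half stays kinetic).  Limit content: the `J`-odd part of the contact law relative to the
KINETIC-SCALE local one-body law vanishes — twisted balance with the twist that the H-split actually wants. [folklore] -/
def MesoShellOddSymmetry : Prop :=
  ∃ η₀ : ℝ, 0 < η₀ ∧ ∀ (a₀ θ₀ : T3 → ℝ) (u₀ : T3 → V3), Continuous a₀ → Continuous θ₀ → Continuous u₀ →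
    (∀ x, 0 < a₀ x) → (∀ x, 0 < θ₀ x) → ∃ σ₀ : ℝ, 0 < σ₀ ∧ ∀ σ : ℝ, 0 < σ → σ < σ₀ →
    ∀ Φ : (N : ℕ) → HardSphereFlow (Torus.geometry (Fin 3)) (hsDiameter σ N) (N + 1),
    ∀ τ : ℝ, 0 < τ → ∀ χ : ℝ × UnitAddTorus (Fin 3) → ℝ, Continuous χ →
    ∀ g : ℝ → ℝ, Continuous g → (∀ b, η₀ ≤ b → g b = 0) →
    ∀ Ψ : V3 × V3 × V3 → ℝ, Continuous Ψ → (∃ C : ℝ, ∀ q, |Ψ q| ≤ C) →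
    (∃ R : ℝ, ∀ q, R ≤ ‖q.2.1‖ ^ 2 + ‖q.2.2‖ ^ 2 → Ψ q = 0) →
    (∀ (n v w : V3), ‖n‖ = 1 → Ψ (-n, (reflectVel n (v, w)).1, (reflectVel n (v, w)).2) = -Ψ (n, v, w)) →
    ∀ a : ℝ, 0 < a → a < 1 / 18 →
    ∀ η δ : ℝ, 0 < η → 0 < δ → ∃ ϑ₀ : ℝ, 0 < ϑ₀ ∧ ∀ ϑ : ℝ, 0 < ϑ → ϑ < ϑ₀ → ∃ N₀ : ℕ, ∀ N : ℕ, N₀ ≤ N →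
      localGibbsLaw σ a₀ u₀ θ₀ N (Φ N)
        {z | η < |oddStat σ N (Φ N) τ χ g Ψ (((N + 1 : ℕ) : ℝ) ^ (-(1 / 3 : ℝ) + a)) ϑ z|} ≤ ENNReal.ofReal δ

/-- **The bet of card A — `OddTwistCost`: sustained mesoscopic twisted odd flux is superexponentially rare at equilibrium.**
Under the INVARIANT homogeneous law `G_N = localGibbsLaw σ 1 0 θe N (Φ N)` (flow-invariant: shared support
`GibbsInvariance`, stmt-9239; rung-0 instance landed p72343) the trajectory event "the mesoscopically-twisted,
shell-supported, density-cut-off J-odd collision statistic over `[0, τ]` exceeds `η`" has probability `≤ e^{−M(N+1)}`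
eventually in `N`, for EVERY `M` — the deterministic analogue of the superexponential replacement estimate
(Kipnis–Landim Ch. 10 Thm 3.1) for THIS functional, sibling of `SuperextensiveClosureCost.MomentumClosureCost`
(stmt-14424) with the two caps that route needs supplied by the crux's own hygiene (energy shell = speed cap,
`g` = packing cap).  Why superexponential is plausible HERE and was not for `odd-replacement-lemma`: at scale `r_N` the
mollified law is never a thermodynamic mixture on positive space-time volume for ANY finite-energy datum (sub-`r_N`
structure dies in time `r_N² Kn⁻¹ = (N+1)^{−1/3+2a} → 0` and is not regenerated below the dissipation scale), holes on
the shell cost `e^{−cN^{3a}}` each and `≍ N^{4/3−9a}` of them are needed (`a < 1/18`), fast spheres and dense pockets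
are cut off; what is left to move the statistic is kinetic non-equilibrium or `J`-odd correlations SUSTAINED over
`≍ N^{4/3} η` collisions, whose natural cost is the dynamical-entropy rate `≍ N^{4/3}` (Kifer 1990 / Young 1990
heuristic, `PesinPricing.KiferYoungUpperR`). [folklore] -/
def OddTwistCost : Prop :=
  ∃ η₀ : ℝ, 0 < η₀ ∧ ∀ θe : ℝ, 0 < θe → ∃ σ₀ : ℝ, 0 < σ₀ ∧ ∀ σ : ℝ, 0 < σ → σ < σ₀ →
    ∀ Φ : (N : ℕ) → HardSphereFlow (Torus.geometry (Fin 3)) (hsDiameter σ N) (N + 1),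
    ∀ τ : ℝ, 0 < τ → ∀ χ : ℝ × UnitAddTorus (Fin 3) → ℝ, Continuous χ → (∃ C : ℝ, ∀ p, |χ p| ≤ C) →
    ∀ g : ℝ → ℝ, Continuous g → (∀ b, η₀ ≤ b → g b = 0) →
    ∀ Ψ : V3 × V3 × V3 → ℝ, Continuous Ψ → (∃ C : ℝ, ∀ q, |Ψ q| ≤ C) →
    (∃ R : ℝ, ∀ q, R ≤ ‖q.2.1‖ ^ 2 + ‖q.2.2‖ ^ 2 → Ψ q = 0) →
    (∀ (n v w : V3), ‖n‖ = 1 → Ψ (-n, (reflectVel n (v, w)).1, (reflectVel n (v, w)).2) = -Ψ (n, v, w)) →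
    ∀ a : ℝ, 0 < a → a < 1 / 18 →
    ∀ η : ℝ, 0 < η → ∃ ϑ₀ : ℝ, 0 < ϑ₀ ∧ ∀ ϑ : ℝ, 0 < ϑ → ϑ < ϑ₀ → ∀ M : ℝ, ∃ N₀ : ℕ, ∀ N : ℕ, N₀ ≤ N →
      localGibbsLaw σ (fun _ => 1) (fun _ => 0) (fun _ => θe) N (Φ N)
        {z | η < |oddStat σ N (Φ N) τ χ g Ψ (((N + 1 : ℕ) : ℝ) ^ (-(1 / 3 : ℝ) + a)) ϑ z|} ≤
        ENNReal.ofReal (Real.exp (-(M * ((N : ℝ) + 1))))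

/-- **The arithmetic of the transfer (PROVED).**  A static `L²` budget `LG(S)² ≤ e^{C n} G(S)` (shared support
`SuperextensiveClosureCost.TransferInequality`, stmt-9512, Cauchy–Schwarz against the invariant law) and a
superexponential equilibrium estimate `G(S) ≤ e^{−M n}` give `LG(S) ≤ e^{(C−M) n/2}`, which is `→ 0` (indeed
superexponentially) as soon as `M > C`: this is the whole passage `OddTwistCost ∧ TransferInequality ⇒
MesoShellOddSymmetry` at the level of numbers (the set-theoretic bookkeeping — same event `S` under both laws, `G`
flow-invariant — is the skeleton's business). [folklore] -/
theorem transfer_of_cost {x y C M n : ℝ} (hy0 : 0 ≤ y)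
    (hbudget : y ^ 2 ≤ Real.exp (C * n) * x) (hcost : x ≤ Real.exp (-(M * n))) :
    y ≤ Real.exp ((C - M) * n / 2) := by
  have h1 : y ^ 2 ≤ Real.exp (C * n) * Real.exp (-(M * n)) :=
    hbudget.trans (mul_le_mul_of_nonneg_left hcost (Real.exp_nonneg _))
  have h2 : Real.exp (C * n) * Real.exp (-(M * n)) = Real.exp ((C - M) * n / 2) ^ 2 := by
    rw [← Real.exp_add, sq, ← Real.exp_add]
    congr 1
    ring
  rw [h2] at h1
  exact (sq_le_sq₀ hy0 (Real.exp_nonneg _)).1 h1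

/-! ## §B  Card `collision-flux-first-moment` -/

/-- **Rung-0 collision-flux identity (First lemma of card B, typed): the Palm law of incoming contact data under the
invariant Gibbs law is flux-weighted chaotic-Maxwellian, up to ONE scalar.**  Under `G_N = localGibbsLaw σ 1 0 θe N Φ`
(ANY flow `Φ`; `G_N` is `Φ.flow`-invariant) the expectation of the unweighted collision sum `K_N[χ Ξ]`
(`collisionSum … χ 1 Ξ r`, density cutoff inert) of ANY bounded continuous mark `Ξ(n̂, v⁻, w⁻)` factorises as
(time–space integral of the deterministic weight `χ`) × (the contact value `Y_N ≥ 0` of the `N+1`-sphere canonical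
ensemble, ONE number independent of `Ξ`, `χ`, `τ`) × (the static Boltzmann integral of `Ξ` against the flux kernel and
two Maxwellians at temperature `θe`).  Mechanism: stationarity makes the collision process a stationary marked point
process whose intensity measure is, by the boundary-flux (Santaló) formula for the a.e. flow (tree, collision
coordinates: `lintegral_eq_boundaryFlux_contact`, `lintegral_eq_boundaryFlux_backward`), the Gibbs density traced on
the incoming contact boundary with weight `((w−v)·n̂)₊ ε²`; positions and velocities are independent under `G_N`, so the
velocity–angle structure is exactly `hardSphereKernel · M ⊗ M`.  Consequences used by the card: rung-0
CollisionTightness in mean (`Ξ ≡ 1`), the EXACT vanishing of the rung-0 mean of every J-odd unweighted statistic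
(`RungZeroOddMeanExact`), and — applied to configuration-dependent marks through the full flux measure — the
first-moment control of "bad" collisions (`meas_one_le_count_le_lintegral`). [folklore] -/
def EquilibriumCollisionFlux : Prop :=
  ∀ (σ θe : ℝ), 0 < σ → σ < 1 / 2 → 0 < θe → ∀ (N : ℕ)
    (Φ : HardSphereFlow (Torus.geometry (Fin 3)) (hsDiameter σ N) (N + 1)),
    ∃ Y : ℝ, 0 ≤ Y ∧ ∀ τ : ℝ, 0 < τ → ∀ χ : ℝ × UnitAddTorus (Fin 3) → ℝ, Continuous χ →
      (∃ C : ℝ, ∀ p, |χ p| ≤ C) → ∀ Ξ : V3 × V3 × V3 → ℝ, Continuous Ξ → (∃ C : ℝ, ∀ q, |Ξ q| ≤ C) → ∀ r : ℝ,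
      ∫ z, collisionSum σ N Φ τ χ (fun _ => 1) Ξ r z ∂(localGibbsLaw σ (fun _ => 1) (fun _ => 0) (fun _ => θe) N Φ) =
        σ ^ 3 * ((N : ℝ) / ((N : ℝ) + 1)) * Y *
          (∫ s in Set.Icc (0 : ℝ) τ, ∫ x : UnitAddTorus (Fin 3), χ (s, x)) *
          ∫ p : V3 × V3, sphereMark Ξ p.1 p.2 * (localMaxwellian 1 θe 0 p.1 * localMaxwellian 1 θe 0 p.2)

/-- **Corollary (typed): the rung-0 mean of every UNWEIGHTED J-odd collision statistic vanishes EXACTLY at every `N`.**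
From `EquilibriumCollisionFlux` and the static parity of the Boltzmann integral (`J`-substitution: the flux kernel, the
Maxwellian pair weight and `dω dv dw` are `J`-invariant — tree `hardSphereKernel_collide_neg`,
`measurePreserving_swap_negDir`, `measurePreserving_collideSwap_prod` — while `Ξ` flips sign).  It isolates where the
reweighted statistic's finite-`N` rung-0 mean `−(∫χ)·ν(gΨ sinh F)` (triage r1-1 sharpen (1)) comes from: entirely from the
configuration-dependence of the twist, which the FULL flux measure (Gibbs trace on the contact boundary) prices by the
same first-moment formula. [folklore] -/
def RungZeroOddMeanExact : Prop :=
  ∀ (σ θe : ℝ), 0 < σ → σ < 1 / 2 → 0 < θe → ∀ (N : ℕ)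
    (Φ : HardSphereFlow (Torus.geometry (Fin 3)) (hsDiameter σ N) (N + 1)),
    ∀ τ : ℝ, 0 < τ → ∀ χ : ℝ × UnitAddTorus (Fin 3) → ℝ, Continuous χ → (∃ C : ℝ, ∀ p, |χ p| ≤ C) →
    ∀ Ξ : V3 × V3 × V3 → ℝ, Continuous Ξ → (∃ C : ℝ, ∀ q, |Ξ q| ≤ C) →
    (∀ (n v w : V3), ‖n‖ = 1 → Ξ (-n, (reflectVel n (v, w)).1, (reflectVel n (v, w)).2) = -Ξ (n, v, w)) → ∀ r : ℝ,
      ∫ z, collisionSum σ N Φ τ χ (fun _ => 1) Ξ r z ∂(localGibbsLaw σ (fun _ => 1) (fun _ => 0) (fun _ => θe) N Φ) = 0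

/-- **Counting Markov (PROVED): "no bad collision ever happens" is a first-moment statement.**  For an `ℕ`-valued
measurable count `X` (e.g. the number of collisions in `[0, τ]` at which some query of the shell-supported mark meets an
`ϑ`-irregular `r`-ball cloud, or a depleted ball), `P(X ≥ 1) ≤ E[X]`; with `EquilibriumCollisionFlux`-type first-moment
formulas, `E[X] = τ × (flux measure of the bad contact configurations)`, a STATIC large-deviation quantity under the
contact-conditioned Gibbs law — this is how card B lands the new content S1′ of the repaired crux (weights bounded at
every contributing collision w.h.p.) at rung 0 without any dynamics beyond invariance. [folklore] -/
theorem meas_one_le_count_le_lintegral {Ω : Type*} [MeasurableSpace Ω] (μ : Measure Ω) (X : Ω → ℕ)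
    (hX : Measurable X) :
    μ {z | (1 : ℝ≥0∞) ≤ (X z : ℝ≥0∞)} ≤ ∫⁻ z, (X z : ℝ≥0∞) ∂μ := by
  have h := mul_meas_ge_le_lintegral₀ (μ := μ) (f := fun z => (X z : ℝ≥0∞))
    (by fun_prop : AEMeasurable (fun z => (X z : ℝ≥0∞)) μ) 1
  simpa using h

end Summit.AtomisticToContinuum.HydrodynamicLimit.Cruxes.OddContactSymmetry.IdeatorFour

end
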